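import Summits.ResolutionOfSingularities.ResolutionOfSingularities.Theorems.FrobeniusLadderFInjectiveMacaulayficationPolynomialLocalizationClause
import Summits.ResolutionOfSingularities.ResolutionOfSingularities.Theorems.FrobeniusLadderFInjectiveMacaulayficationClauseOfMaximal
import Mathlib.RingTheory.Localization.Algebra
import Mathlib.RingTheory.Localization.LocalizationLocalization
import Mathlib.RingTheory.LocalRing.ResidueField.Basic
import Mathlib.Algebra.Polynomial.Lifts
import Mathlib.Algebra.Polynomial.Inductions
import Mathlib.Algebra.Polynomial.Degree.Lemmas
import HarnessLib

/-!
# The Cohen–Macaulay + F-injective clause ascends along `R → R[t]` at EVERY prime (all residue fields)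
# (crux `FInjectiveMacaulayfication` stmt-ResolutionOfSingularities-15315, chain w45a; R11.11 cylinder producer, steps S1c/S2;
# owner res-D-pv-017 AS res-L1-w45a-stub-5)

Support file for crux stmt-ResolutionOfSingularities-15315 (`FrobeniusLadder.FInjectiveMacaulayfication`), chain w45a.
[OURS · L1 W4.5a] — NOT a statement of any manuscript; AI-written, weaker than expert review.

* `clause_atPrime_of_le` — the clause passes from `R_Q` to `R_P`, `P ≤ Q` (E5 + `R_P ≅ (R_Q)_{P R_Q}`; the domain-free form of
  `ClauseOfMaximal.fiClause_atPrime_of_le`).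
* `eq_map_C_or_exists_monic` — a prime `P` of `A[t]` over the maximal ideal of a local ring `A` is `𝔪A[t]` or `𝔪A[t] + (g)` with
  `g` monic of positive degree (lift of the monic generator of its image in `k[t]`).
* `clause_polynomial_localization` — `(A, 𝔪)` Noetherian local of characteristic `p` with the clause, `P` any prime of `A[t]`
  over `𝔪` ⟹ the clause for `A[t]_P` (S1b `clause_polynomial_localization_of_monic` for `𝔪A[t] + (g)`; `𝔪A[t]` by localizing
  the case `g = t`).
* `clause_polynomial_atPrime` — `A` Noetherian of characteristic `p` with the clause at all its local rings ⟹ the clause at all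
  local rings of `A[t]` (`A[t]_P ≅ (A_𝔭[t])_{P'}`, `Polynomial.isLocalization`).
In short: «Cohen–Macaulay + F-injective (in the crux's clause language) ascends along `R → R[t]`», for every residue field,
separable or not — the input of the cylinder producer (R11.11) and of «hoff ⇒ hoff′» for `CNCylinder.strongPlusStep_cylinder_of_cnData`.
No definitions, no named facts. [folklore; cf. DattaMurayama2020 Thm A]
-/

-- single-problem summit: the doubled namespace component is forced
set_option linter.dupNamespace false

noncomputable section

open Polynomial IsLocalRing RingTheory.Sequence Literature.RingTheory.TightClosure

namespace Summit.ResolutionOfSingularities.ResolutionOfSingularities.Theorems.FInjectiveMacaulayfication.PolynomialLocalizationClause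

open Summit.ResolutionOfSingularities.ResolutionOfSingularities.Theorems.FInjectiveMacaulayfication

/-- **The clause passes from `R_Q` to `R_P` for primes `P ≤ Q`** (`R` Noetherian of characteristic `p`; no domain hypothesis):
`R_P ≅ (R_Q)_{P R_Q}` and E5 `ClauseLocalizes.clause_localization`. [folklore] -/
theorem clause_atPrime_of_le (p : ℕ) [Fact p.Prime] {R : Type} [CommRing R] [IsNoetherianRing R] [CharP R p]
    {P Q : Ideal R} [P.IsPrime] [Q.IsPrime] (hPQ : P ≤ Q)
    (hQ : ∀ d : ℕ, ringKrullDim (Localization.AtPrime Q) = d → ∀ s : Fin d → Localization.AtPrime Q,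
      (Ideal.span (Set.range s)).radical.IsMaximal →
        IsWeaklyRegular (Localization.AtPrime Q) (List.ofFn s) ∧
        ∀ y : Localization.AtPrime Q, (∃ e : ℕ, y ^ p ^ e ∈ Ideal.span
          ((fun z : Localization.AtPrime Q => z ^ p ^ e) ''
            (Ideal.span (Set.range s) : Set (Localization.AtPrime Q)))) → y ∈ Ideal.span (Set.range s)) :
    ∀ d : ℕ, ringKrullDim (Localization.AtPrime P) = d → ∀ s : Fin d → Localization.AtPrime P,
      (Ideal.span (Set.range s)).radical.IsMaximal →
        IsWeaklyRegular (Localization.AtPrime P) (List.ofFn s) ∧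
        ∀ y : Localization.AtPrime P, (∃ e : ℕ, y ^ p ^ e ∈ Ideal.span
          ((fun z : Localization.AtPrime P => z ^ p ^ e) ''
            (Ideal.span (Set.range s) : Set (Localization.AtPrime P)))) → y ∈ Ideal.span (Set.range s) := by
  haveI : CharP (Localization.AtPrime Q) p := DegreeZeroDescent.charP_localization_atPrime p Q
  haveI hP' : (P.map (algebraMap R (Localization.AtPrime Q))).IsPrime :=
    Ideal.isPrime_map_of_isLocalizationAtPrime Q hPQ
  have hcomap : (P.map (algebraMap R (Localization.AtPrime Q))).comap
      (algebraMap R (Localization.AtPrime Q)) = P :=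
    Ideal.under_map_of_isLocalizationAtPrime Q hPQ
  have hloc := ClauseLocalizes.clause_localization p hQ (P.map (algebraMap R (Localization.AtPrime Q)))
  haveI : IsLocalization.AtPrime
      (Localization.AtPrime (P.map (algebraMap R (Localization.AtPrime Q)))) P := by
    have h := IsLocalization.isLocalization_atPrime_localization_atPrime (M := Q.primeCompl)
      (P.map (algebraMap R (Localization.AtPrime Q)))
    have hM : ((P.map (algebraMap R (Localization.AtPrime Q))).comap
        (algebraMap R (Localization.AtPrime Q))).primeCompl = P.primeCompl := by
      ext x
      rw [Ideal.mem_primeCompl_iff, Ideal.mem_primeCompl_iff, hcomap]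
    change IsLocalization P.primeCompl _
    rw [← hM]
    exact h
  let e : Localization.AtPrime (P.map (algebraMap R (Localization.AtPrime Q))) ≃+*
      Localization.AtPrime P :=
    (IsLocalization.algEquiv P.primeCompl
      (Localization.AtPrime (P.map (algebraMap R (Localization.AtPrime Q)))) (Localization.AtPrime P)).toRingEquiv
  exact DegreeZeroDescent.inlineClause_of_ringEquiv
    (L := Localization.AtPrime (P.map (algebraMap R (Localization.AtPrime Q)))) (L' := Localization.AtPrime P) p e hloc

/-- `𝔪A[t] + (t)` is the kernel of `A[t] → A → k`, `f ↦ f(0) mod 𝔪`; in particular it is prime. [folklore] -/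
theorem map_C_sup_span_X_eq_ker {A : Type*} [CommRing A] [IsLocalRing A] :
    (maximalIdeal A).map (C : A →+* A[X]) ⊔ Ideal.span {(X : A[X])} =
      RingHom.ker ((residue A).comp (evalRingHom 0)) := by
  apply le_antisymm
  · refine sup_le (Ideal.map_le_iff_le_comap.mpr fun m hm => ?_) ((Ideal.span_singleton_le_iff_mem _).mpr ?_)
    · rw [Ideal.mem_comap, RingHom.mem_ker, RingHom.comp_apply, coe_evalRingHom, eval_C, residue_eq_zero_iff]
      exact hm
    · rw [RingHom.mem_ker, RingHom.comp_apply, coe_evalRingHom, eval_X, map_zero]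
  · intro f hf
    rw [RingHom.mem_ker, RingHom.comp_apply, coe_evalRingHom, residue_eq_zero_iff, ← coeff_zero_eq_eval_zero] at hf
    rw [← X_mul_divX_add f]
    exact Ideal.add_mem _ (Ideal.mem_sup_right (Ideal.mul_mem_right _ _ (Ideal.mem_span_singleton_self X)))
      (Ideal.mem_sup_left (Ideal.mem_map_of_mem _ hf))

/-- **Primes of `A[t]` over the maximal ideal of a local ring `A`** are `𝔪A[t]` or `𝔪A[t] + (g)` with `g` monic of positive
degree: the image in the principal ideal domain `k[t]` is `0` or generated by a monic polynomial, which lifts to a monic `g`.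
[folklore] -/
theorem eq_map_C_or_exists_monic {A : Type*} [CommRing A] [IsLocalRing A] (P : Ideal A[X]) [P.IsPrime]
    (hPc : P.comap (C : A →+* A[X]) = maximalIdeal A) :
    P = (maximalIdeal A).map (C : A →+* A[X]) ∨
      ∃ g : A[X], g.Monic ∧ 0 < g.natDegree ∧ P = (maximalIdeal A).map (C : A →+* A[X]) ⊔ Ideal.span {g} := by
  classical
  set π : A[X] →+* (ResidueField A)[X] := mapRingHom (residue A) with hπ_def
  have hπ : Function.Surjective π := Polynomial.map_surjective _ residue_surjective
  have hker : RingHom.ker π = (maximalIdeal A).map (C : A →+* A[X]) := by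
    rw [hπ_def, ker_mapRingHom, ker_residue]
  have hkerP : RingHom.ker π ≤ P := by
    rw [hker, ← hPc]; exact Ideal.map_comap_le
  haveI hP' : (P.map π).IsPrime := Ideal.map_isPrime_of_surjective hπ hkerP
  have hPcomap : (P.map π).comap π = P := by
    rw [Ideal.comap_map_of_surjective π hπ, sup_eq_left]
    exact le_trans (fun z hz => hz) hkerP
  obtain ⟨q₀, hq₀⟩ := (IsPrincipalIdealRing.principal (P.map π)).principal
  change P.map π = Ideal.span {q₀} at hq₀
  by_cases hq0 : q₀ = 0
  · left
    rw [← hPcomap, hq₀, hq0, Ideal.span_singleton_zero, ← RingHom.ker_eq_comap_bot, hker]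
  · right
    have hmonic : (q₀ * C (q₀.leadingCoeff)⁻¹).Monic := monic_mul_leadingCoeff_inv hq0
    have hspan : Ideal.span {q₀ * C (q₀.leadingCoeff)⁻¹} = Ideal.span {q₀} :=
      Ideal.span_singleton_mul_right_unit (isUnit_C.mpr (IsUnit.mk0 _ (inv_ne_zero (leadingCoeff_ne_zero.mpr hq0)))) q₀
    obtain ⟨g, hgmap, hgdeg, hg⟩ := lifts_and_degree_eq_and_monic ((mem_lifts _).mpr (hπ _)) hmonic
    refine ⟨g, hg, ?_, ?_⟩
    · rw [natDegree_eq_of_degree_eq hgdeg, Nat.pos_iff_ne_zero, Ne, hmonic.natDegree_eq_zero]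
      intro h1
      apply hP'.ne_top
      rw [hq₀, ← hspan, h1, Ideal.span_singleton_one]
    · rw [← hPcomap, hq₀, ← hspan, ← hgmap]
      change Ideal.comap π (Ideal.span {π g}) = _
      rw [← Set.image_singleton, ← Ideal.map_span, Ideal.comap_map_of_surjective π hπ, ← RingHom.ker_eq_comap_bot, hker,
        sup_comm]

/-- **The clause ascends along `A → A[t]_P` for every prime `P` over `𝔪`** (`(A, 𝔪)` Noetherian local of characteristic `p`
with the clause; every residue field). [folklore; cf. DattaMurayama2020 Thm A] -/
theorem clause_polynomial_localization (p : ℕ) [Fact p.Prime] (A : Type) [CommRing A] [IsNoetherianRing A]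
    [IsLocalRing A] [CharP A p]
    (hA : ∀ d : ℕ, ringKrullDim A = d → ∀ s : Fin d → A, (Ideal.span (Set.range s)).radical.IsMaximal →
      IsWeaklyRegular A (List.ofFn s) ∧
      ∀ y : A, (∃ e : ℕ, y ^ p ^ e ∈ Ideal.span ((fun z : A => z ^ p ^ e) '' (Ideal.span (Set.range s) : Set A))) →
        y ∈ Ideal.span (Set.range s))
    (P : Ideal A[X]) [P.IsPrime] (hPc : P.comap (C : A →+* A[X]) = maximalIdeal A) :
    ∀ d : ℕ, ringKrullDim (Localization.AtPrime P) = d → ∀ s : Fin d → Localization.AtPrime P,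
      (Ideal.span (Set.range s)).radical.IsMaximal →
      IsWeaklyRegular (Localization.AtPrime P) (List.ofFn s) ∧
      ∀ y : Localization.AtPrime P, (∃ e : ℕ, y ^ p ^ e ∈ Ideal.span
        ((fun z : Localization.AtPrime P => z ^ p ^ e) ''
          (Ideal.span (Set.range s) : Set (Localization.AtPrime P)))) → y ∈ Ideal.span (Set.range s) := by
  rcases eq_map_C_or_exists_monic P hPc with hP | ⟨g, hg, hg1, hP⟩
  · haveI hP₀ : ((maximalIdeal A).map (C : A →+* A[X]) ⊔ Ideal.span {(X : A[X])}).IsPrime := by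
      rw [map_C_sup_span_X_eq_ker]; exact RingHom.ker_isPrime _
    have h₀ := clause_polynomial_localization_of_monic p A hA X monic_X (by rw [natDegree_X]; exact one_pos) _ rfl
    have hle : P ≤ (maximalIdeal A).map (C : A →+* A[X]) ⊔ Ideal.span {(X : A[X])} := by rw [hP]; exact le_sup_left
    exact clause_atPrime_of_le p hle h₀
  · exact clause_polynomial_localization_of_monic p A hA g hg hg1 P hP

set_option maxHeartbeats 800000 in
/-- **Cohen–Macaulay + F-injectivity (the crux's clause) ascend along `R → R[t]`**: if every local ring of a Noetherian ring `A`
of characteristic `p` satisfies the clause, so does every local ring `A[t]_P` of the polynomial ring — `A[t]_P ≅ (A_𝔭[t])_{P'}`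
with `𝔭 = P ∩ A` (`Polynomial.isLocalization`, localization of a localization) and `clause_polynomial_localization` over the
local ring `A_𝔭`. Every residue field, separable or not. [folklore; cf. DattaMurayama2020 Thm A] -/
theorem clause_polynomial_atPrime (p : ℕ) [Fact p.Prime] (A : Type) [CommRing A] [IsNoetherianRing A] [CharP A p]
    (hA : ∀ (𝔭 : Ideal A) [𝔭.IsPrime], ∀ d : ℕ, ringKrullDim (Localization.AtPrime 𝔭) = d →
      ∀ s : Fin d → Localization.AtPrime 𝔭, (Ideal.span (Set.range s)).radical.IsMaximal →
        IsWeaklyRegular (Localization.AtPrime 𝔭) (List.ofFn s) ∧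
        ∀ y : Localization.AtPrime 𝔭, (∃ e : ℕ, y ^ p ^ e ∈ Ideal.span
          ((fun z : Localization.AtPrime 𝔭 => z ^ p ^ e) '' (Ideal.span (Set.range s) : Set (Localization.AtPrime 𝔭)))) →
          y ∈ Ideal.span (Set.range s))
    (P : Ideal A[X]) [P.IsPrime] :
    ∀ d : ℕ, ringKrullDim (Localization.AtPrime P) = d → ∀ s : Fin d → Localization.AtPrime P,
      (Ideal.span (Set.range s)).radical.IsMaximal →
      IsWeaklyRegular (Localization.AtPrime P) (List.ofFn s) ∧
      ∀ y : Localization.AtPrime P, (∃ e : ℕ, y ^ p ^ e ∈ Ideal.span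
        ((fun z : Localization.AtPrime P => z ^ p ^ e) ''
          (Ideal.span (Set.range s) : Set (Localization.AtPrime P)))) → y ∈ Ideal.span (Set.range s) := by
  -- `𝔭 = P ∩ A`, `S = A_𝔭[t]` a localization of `A[t]`
  set 𝔭 : Ideal A := P.comap (C : A →+* A[X]) with h𝔭
  haveI : CharP (Localization.AtPrime 𝔭) p := DegreeZeroDescent.charP_localization_atPrime p 𝔭
  letI algS : Algebra A[X] (Localization.AtPrime 𝔭)[X] := Polynomial.algebra A (Localization.AtPrime 𝔭)
  haveI hS : IsLocalization (𝔭.primeCompl.map (C : A →+* A[X])) (Localization.AtPrime 𝔭)[X] :=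
    Polynomial.isLocalization 𝔭.primeCompl (Localization.AtPrime 𝔭)
  have halgS : ∀ f : A[X], algebraMap A[X] (Localization.AtPrime 𝔭)[X] f = f.map (algebraMap A (Localization.AtPrime 𝔭)) :=
    fun f => rfl
  have hdisj : Disjoint (↑(𝔭.primeCompl.map (C : A →+* A[X])) : Set A[X]) (↑P : Set A[X]) := by
    rw [Set.disjoint_left]
    rintro _ ⟨a, ha, rfl⟩ haP
    exact ha haP
  -- `P' = P·S`, a prime of `S` over `P` and over the maximal ideal of `A_𝔭`
  haveI hP' : (P.map (algebraMap A[X] (Localization.AtPrime 𝔭)[X])).IsPrime :=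
    IsLocalization.isPrime_of_isPrime_disjoint (𝔭.primeCompl.map (C : A →+* A[X])) (Localization.AtPrime 𝔭)[X] P
      inferInstance hdisj
  have hunder : (P.map (algebraMap A[X] (Localization.AtPrime 𝔭)[X])).comap (algebraMap A[X] (Localization.AtPrime 𝔭)[X]) = P :=
    IsLocalization.under_map_of_isPrime_disjoint (𝔭.primeCompl.map (C : A →+* A[X])) (Localization.AtPrime 𝔭)[X]
      inferInstance hdisj
  have hP'c : (P.map (algebraMap A[X] (Localization.AtPrime 𝔭)[X])).comap (C : Localization.AtPrime 𝔭 →+* (Localization.AtPrime 𝔭)[X]) =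
      maximalIdeal (Localization.AtPrime 𝔭) := by
    have hcomp : (C : Localization.AtPrime 𝔭 →+* (Localization.AtPrime 𝔭)[X]).comp (algebraMap A (Localization.AtPrime 𝔭)) =
        (algebraMap A[X] (Localization.AtPrime 𝔭)[X]).comp (C : A →+* A[X]) :=
      RingHom.ext fun a => by rw [RingHom.comp_apply, RingHom.comp_apply, halgS, map_C]
    have h1 : ((P.map (algebraMap A[X] (Localization.AtPrime 𝔭)[X])).comap
        (C : Localization.AtPrime 𝔭 →+* (Localization.AtPrime 𝔭)[X])).under A = 𝔭 := by
      rw [Ideal.under_def, Ideal.comap_comap, hcomp, ← Ideal.comap_comap, hunder]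
    calc (P.map (algebraMap A[X] (Localization.AtPrime 𝔭)[X])).comap (C : Localization.AtPrime 𝔭 →+* (Localization.AtPrime 𝔭)[X])
        = (((P.map (algebraMap A[X] (Localization.AtPrime 𝔭)[X])).comap
            (C : Localization.AtPrime 𝔭 →+* (Localization.AtPrime 𝔭)[X])).under A).map (algebraMap A (Localization.AtPrime 𝔭)) :=
          (IsLocalization.map_under (M := 𝔭.primeCompl) (S := Localization.AtPrime 𝔭) _).symm
      _ = 𝔭.map (algebraMap A (Localization.AtPrime 𝔭)) := by rw [h1]
      _ = maximalIdeal (Localization.AtPrime 𝔭) := IsLocalization.AtPrime.map_eq_maximalIdeal 𝔭 _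
  -- the clause at `T = S_{P'}`
  have hT := clause_polynomial_localization p (Localization.AtPrime 𝔭) (fun d hd s hs => hA 𝔭 d hd s hs)
    (P.map (algebraMap A[X] (Localization.AtPrime 𝔭)[X])) hP'c
  -- `T` is the localization of `A[t]` at `P`
  haveI : IsLocalization.AtPrime (Localization.AtPrime (P.map (algebraMap A[X] (Localization.AtPrime 𝔭)[X]))) P := by
    have h := IsLocalization.isLocalization_isLocalization_atPrime_isLocalization (𝔭.primeCompl.map (C : A →+* A[X]))
      (T := Localization.AtPrime (P.map (algebraMap A[X] (Localization.AtPrime 𝔭)[X])))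
      (P.map (algebraMap A[X] (Localization.AtPrime 𝔭)[X]))
    have hM : ((P.map (algebraMap A[X] (Localization.AtPrime 𝔭)[X])).comap
        (algebraMap A[X] (Localization.AtPrime 𝔭)[X])).primeCompl = P.primeCompl := by
      ext x
      rw [Ideal.mem_primeCompl_iff, Ideal.mem_primeCompl_iff, hunder]
    change IsLocalization P.primeCompl _
    rw [← hM]
    exact h
  let e : Localization.AtPrime (P.map (algebraMap A[X] (Localization.AtPrime 𝔭)[X])) ≃+* Localization.AtPrime P :=
    (IsLocalization.algEquiv P.primeCompl
      (Localization.AtPrime (P.map (algebraMap A[X] (Localization.AtPrime 𝔭)[X]))) (Localization.AtPrime P)).toRingEquiv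
  exact DegreeZeroDescent.inlineClause_of_ringEquiv
    (L := Localization.AtPrime (P.map (algebraMap A[X] (Localization.AtPrime 𝔭)[X]))) (L' := Localization.AtPrime P) p e hT

end Summit.ResolutionOfSingularities.ResolutionOfSingularities.Theorems.FInjectiveMacaulayfication.PolynomialLocalizationClause

end
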